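import Summits.MatrixMultiplication.OmegaCensus.STPP222CubeSearch

/-!
# ω-census, `(2,2,2)³` is infeasible in `ℤ/28` — kernel search, part 3 of 3

HONEST FRAMING (pub-omega census; verbatim): lottery ticket; floor = certified bounds/negative ranges.
Census STRUCTURE bookkeeping (question Q7, row `k = 3`, lower half `n₃ ≥ 32`), not progress on `ω`.

Chunks 31–31 of the kernel mask search (`STPP222CubeNeg.searchB3`, `decide +kernel`) over the canonical start list
of `ℤ/28`; assembled with the covering facts in `STPP222CubeNoneZ28.lean`.  Data generated by ENG2 gen 18/19's `cubegen.py`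
(pub-omega HOME `pub-omega-eng2-g19/work/k3/`); predicted kernel time 10 s.

References: H. Cohn, R. Kleinberg, B. Szegedy, C. Umans, FOCS 2005 (arXiv:math/0511460), Def. 5.1.
-/

set_option Elab.async false  -- many kernel pieces: elaborate sequentially (memory)

namespace Summit.MatrixMultiplication.OmegaCensus

namespace STPP222CubeNeg

/-- Start-list chunk 31 of `ℤ/28` (2 entries; 115522 clause evaluations ≈ 10 s predicted). -/
def Z28c.ch31 : List (ℕ × ℕ × ℕ × List ℕ) :=
  [(4, 7, 14, [20, 21, 22, 23, 24, 25, 26, 27]), (4, 8, 14, (List.range 28))]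

/-- Kernel search over chunk 31 of `ℤ/28`. -/
theorem Z28c.s31 : searchB3 (zArith 28) (List.range 28) Z28c.ch31 = true := by
  decide +kernel

end STPP222CubeNeg

end Summit.MatrixMultiplication.OmegaCensus
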